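import Summits.CriticalPhenomena.PercolationContinuityZ3.Theorems.Transplant.SkelPhiParaRunChain
import Summits.CriticalPhenomena.PercolationContinuityZ3.Theorems.Transplant.SkelPhiRootBridgeGeom
import HarnessLib

/-!
# N1 ({±1} node), (F) inner route, part R5b-ii (hp-8 g33): **THE RUN SCHEDULES' PRISM AND CORES AS EXPLICIT BOXES** of the run frame — the
# hypotheses `hprism / hprismY / hlastc` of `faceRoute_of_numbers3_x/_y` (fields of `FaceRunNums`) discharged once and for all from the
# `RunPrm` formulas: `prism = [−q − (N+1)R′ − La, N·sHi + q + (N+1)R′ + La] × [−N|d| − (Wm + (N+1)R′) − Lb, N|d| + (Wp + (N+1)R′) + Lb]` and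
# `core k = [aLo k, aHi k] × [bLo k, bHi k]`, for the x-run (`xPrmW`) and the y′-run (`yPrmW`) schedules (axis `0`, sign `1`, origin `0`).
builds on p205010 (kernel theorem, internal audit signed; external expert review pending) — nothing in this file uses p205010; no claim about the open node.
Lane `prim-bschramm`, seat `prim-hp-8` (gen 33); helper file (`--supports stmt-CriticalPhenomena-4575 --as helper`).
* `Skelφ.scheduleN_prism_subset_pt`, `scheduleN_core_subset_pt`, **`xRunSched_prism_subset`**, **`xRunSched_core_subset`**, **`yRunSched_prism_subset`**,
  **`yRunSched_core_subset`**.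
[cite: KozmaNitzan2024, §4 Lemma 11 (pp. 22–23)] [cite: MartineauTassion2017, §4.3 Lemma 4.2]
-/

noncomputable section

open scoped Classical

namespace Summit.CriticalPhenomena.PercolationContinuityZ3.Theorems.Transplant

namespace Skelφ

open Literature.Probability.Percolation Literature.Probability.LatticeModels
open Literature.Probability.Percolation.KozmaNitzan.Cells (oth)
open ChainPlanar ChainPara

/-- The prism of a run schedule along axis `0`, sign `1`, origin `0` is the explicit box of `InPrism`. [folklore] -/
theorem scheduleN_prism_subset_pt (P : RunPrm) (hP : RunOK P) (heb : P.eb = P.ea) :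
    (P.scheduleN 0 (σ := 1) (Or.inl rfl) 0 hP heb).prism ⊆
      Finset.Icc (pt (-(P.q : ℤ) - ((P.N : ℤ) + 1) * P.ea - P.La) (-((P.N : ℤ) * |P.d|) - (P.Wm + ((P.N : ℤ) + 1) * P.eb) - P.Lb))
        (pt ((P.N : ℤ) * P.sHi + P.q + ((P.N : ℤ) + 1) * P.ea + P.La) ((P.N : ℤ) * |P.d| + (P.Wp + ((P.N : ℤ) + 1) * P.eb) + P.Lb)) := by
  intro y hy
  rw [RunPrm.scheduleN_prism, RunPrm.mem_pprism_iff (Or.inl rfl)] at hy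
  obtain ⟨h1, h2, h3, h4⟩ := hy
  simp only [Pi.zero_apply, sub_zero, one_mul, show oth (0 : Fin 2) = 1 from rfl] at h1 h2 h3 h4
  rw [mem_Icc_pt_iff]
  exact ⟨⟨h1, h2⟩, h3, h4⟩

/-- Core `k` of a run schedule along axis `0`, sign `1`, origin `0` is the explicit box `[aLo k, aHi k] × [bLo k, bHi k]`. [folklore] -/
theorem scheduleN_core_subset_pt (P : RunPrm) (hP : RunOK P) (heb : P.eb = P.ea) (k : ℕ) :
    (P.scheduleN 0 (σ := 1) (Or.inl rfl) 0 hP heb).core k ⊆ Finset.Icc (pt (P.aLo k) (P.bLo k)) (pt (P.aHi k) (P.bHi k)) := by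
  intro y hy
  rw [RunPrm.scheduleN_core, RunPrm.mem_pcore_iff (Or.inl rfl)] at hy
  obtain ⟨h1, h2, h3, h4⟩ := hy
  simp only [Pi.zero_apply, sub_zero, one_mul, show oth (0 : Fin 2) = 1 from rfl] at h1 h2 h3 h4
  rw [mem_Icc_pt_iff]
  exact ⟨⟨h1, h2⟩, h3, h4⟩

/-- **The x-run's prism** as an explicit box of the frame `runX` (`d = 0`, `Wm = Wp = nℓ/U + 1`, `La = n`, `Lb = 3nℓ/U + 1`).
[cite: KozmaNitzan2024, §4 Lemma 11 (pp. 22–23)] -/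
theorem xRunSched_prism_subset (n ℓ : ℕ) (h : ℤ) (R' q N : ℕ) :
    (xRunSched n ℓ h R' q N).prism ⊆
      Finset.Icc (pt (-(q : ℤ) - ((N : ℤ) + 1) * R' - n) (-(((n * ℓ / shearUnit n h + 1 : ℕ) : ℤ) + ((N : ℤ) + 1) * R') - ((3 * (n * ℓ) / shearUnit n h + 1 : ℕ) : ℤ)))
        (pt ((N : ℤ) * n + q + ((N : ℤ) + 1) * R' + n) ((((n * ℓ / shearUnit n h + 1 : ℕ) : ℤ) + ((N : ℤ) + 1) * R') + ((3 * (n * ℓ) / shearUnit n h + 1 : ℕ) : ℤ))) := by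
  have h0 := scheduleN_prism_subset_pt (xPrmW n ℓ h R' q N) (xPrmW_ok n ℓ h R' q N) (xPrmW_eb n ℓ h R' q N)
  rw [xRunSched]
  refine h0.trans (le_of_eq ?_)
  simp [xPrmW]

/-- **The x-run's core `k`** as an explicit box: `[k·n − q − k·R′, k·n + q + k·R′] × [−(W + k·R′), W + k·R′]`, `W = nℓ/U + 1`. [folklore] -/
theorem xRunSched_core_subset (n ℓ : ℕ) (h : ℤ) (R' q N k : ℕ) :
    (xRunSched n ℓ h R' q N).core k ⊆
      Finset.Icc (pt ((k : ℤ) * n - q - (k : ℤ) * R') (-((((n * ℓ / shearUnit n h + 1 : ℕ) : ℤ)) + (k : ℤ) * R')))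
        (pt ((k : ℤ) * n + q + (k : ℤ) * R') (((n * ℓ / shearUnit n h + 1 : ℕ) : ℤ) + (k : ℤ) * R')) := by
  have h0 := scheduleN_core_subset_pt (xPrmW n ℓ h R' q N) (xPrmW_ok n ℓ h R' q N) (xPrmW_eb n ℓ h R' q N) k
  rw [xRunSched]
  refine h0.trans (le_of_eq ?_)
  simp [xPrmW, RunPrm.aLo, RunPrm.aHi, RunPrm.bLo, RunPrm.bHi]

/-- **The y′-run's prism** as an explicit box of the frame `runY` (`sHi = nℓ/U + 1`, `d = v`, `Wm = (n+v)⁺`, `Wp = (n−v)⁺`, `La = 3nℓ/U + 1`, `Lb = n`).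
[cite: KozmaNitzan2024, §4 Lemma 11 (pp. 22–23)] -/
theorem yRunSched_prism_subset {n ℓ : ℕ} {h v : ℤ} (hn : 1 ≤ n) (hv : |v| ≤ n) (hlay : (n + h.natAbs : ℕ) ≤ (n : ℤ) * ℓ + 1) (R' q N : ℕ) :
    (yRunSched hn hv hlay R' q N).prism ⊆
      Finset.Icc (pt (-(q : ℤ) - ((N : ℤ) + 1) * R' - ((3 * (n * ℓ) / shearUnit n h + 1 : ℕ) : ℤ))
          (-((N : ℤ) * |v|) - (((((n : ℤ) + v).toNat : ℕ) : ℤ) + ((N : ℤ) + 1) * R') - n))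
        (pt ((N : ℤ) * ((n : ℤ) * ℓ / (shearUnit n h : ℕ) + 1) + q + ((N : ℤ) + 1) * R' + ((3 * (n * ℓ) / shearUnit n h + 1 : ℕ) : ℤ))
          ((N : ℤ) * |v| + (((((n : ℤ) - v).toNat : ℕ) : ℤ) + ((N : ℤ) + 1) * R') + n)) := by
  have h0 := scheduleN_prism_subset_pt (yPrmW n ℓ h v R' q N) (yPrmW_ok hn hv hlay R' q N) (yPrmW_eb n ℓ h v R' q N)
  rw [yRunSched]
  refine h0.trans (le_of_eq ?_)
  simp [yPrmW]

/-- **The y′-run's core `k`** as an explicit box: `[k·sLo − q − k·R′, k·sHi + q + k·R′] × [k·v − ((n+v)⁺ + k·R′), k·v + ((n−v)⁺ + k·R′)]`. [folklore] -/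
theorem yRunSched_core_subset {n ℓ : ℕ} {h v : ℤ} (hn : 1 ≤ n) (hv : |v| ≤ n) (hlay : (n + h.natAbs : ℕ) ≤ (n : ℤ) * ℓ + 1) (R' q N k : ℕ) :
    (yRunSched hn hv hlay R' q N).core k ⊆
      Finset.Icc (pt ((k : ℤ) * (((n : ℤ) * ℓ - (shearUnit n h : ℕ) + 1) / (shearUnit n h : ℕ)) - q - (k : ℤ) * R')
          ((k : ℤ) * v - ((((((n : ℤ) + v).toNat : ℕ) : ℤ)) + (k : ℤ) * R')))
        (pt ((k : ℤ) * ((n : ℤ) * ℓ / (shearUnit n h : ℕ) + 1) + q + (k : ℤ) * R') ((k : ℤ) * v + (((((n : ℤ) - v).toNat : ℕ) : ℤ) + (k : ℤ) * R'))) := by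
  have h0 := scheduleN_core_subset_pt (yPrmW n ℓ h v R' q N) (yPrmW_ok hn hv hlay R' q N) (yPrmW_eb n ℓ h v R' q N) k
  rw [yRunSched]
  refine h0.trans (le_of_eq ?_)
  simp [yPrmW, RunPrm.aLo, RunPrm.aHi, RunPrm.bLo, RunPrm.bHi]

end Skelφ

end Summit.CriticalPhenomena.PercolationContinuityZ3.Theorems.Transplant

end
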